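import Summits.QuantumFields.YangMills.Theorems.PoincareLipschitzMeanDeviationOfShallowSecondMoment
import Summits.QuantumFields.YangMills.Theorems.UnitScaleGibbsDressedEventSplitCollar
import Literature.MathematicalPhysics.QuantumFieldTheory.Balaban1983to89.T4AxialGaugeSmallField
import HarnessLib

/-!
# `GrossTransferStubLinTestOfPointwise` — `stub_linTest` (v3.1 TEXT) FROM ITS POINTWISE-ON-THE-EVENT PACKAGE (KNIT-E FILE 1 of LINE 28 «GrossTransfer»;
# crux `UnitScaleTilt.HistoryTailL` stmt-QuantumFields-19936 ∕ `MeanDeviationL` stmt-QuantumFields-23083)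

Cell `ym3-torus` (YM ladder rung R3 = continuum SU(2) Yang–Mills on T³ — a RUNG, NOT the Clay problem: not d = 4, not infinite volume, not a mass gap),
width seat `ym-ust-19936-w2` (gen 15), pen of record of `stub_linTest`.  KNIT-PLAN (23083 evidence #9) splits the re-lined stub (v3.1, evidence #7) into
(I) a DETERMINISTIC-PLUS-POINTWISE PACKAGE — for every reference plaquette the box, the test fields `u_α`, the collar weights `ω` with rows R1–R7, and the
POINTWISE bound on the small-field event `dist₁(Ū^j(∂a))² ≤ C·Σ_α Y_α(U)² + Σ_b ω_b·dist₁((VU)b)² + C·γ·L^{−(K−j)}` (rows P1–P8) — and (II) the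
integration.  THIS FILE is (II), sorry-free: ★★★`stub_linTest_of_pointwisePackage (hP : ⟨package⟩) : ⟨stub_linTest v3.1 text, token for token⟩` by
✓`UnitScaleGibbsDressedEventSplitCollar.integral_dist1_sq_iter_le_of_pointwise_collar` (w2 g15, p744094).  The package (I) is KNIT-E FILE 2 (pen w2; suppliers
P-LOC ✓p741009, LIN-ID ✓, X-KNIT-L ✓p744553, KNIT-A∕C, KNIT-B ✓p745301, COLLAR-COBD ✓p743167, MONOPOLE ✓p743656, CUTOFF ✓p742862, KNIT-D (w3), T-push ✓ (w5)).
HONEST FRAMING.  A conditional knit: proves the stub ONLY from the package hypothesis; proves no stub, crux, rung or summit statement by itself;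
«ShallowFluxSecondMomentL», (Q), K1, `MeanDeviationL`, `HistoryTailL` are NOT proved; the Yang–Mills mass gap is NOT proved.
References: [GrossCMP1983] Thm 2.2; [Balaban1985Averaging] (0.4), (19) p.21; [Balaban1987RG1] (0.1)–(0.4).
-/

noncomputable section

open MeasureTheory
open scoped BigOperators Matrix.Norms.Frobenius
open Literature.MathematicalPhysics.QuantumFieldTheory.Balaban1983to89
open Literature.MathematicalPhysics.QuantumFieldTheory.Balaban1983to89.T3ContinuumYM3Torus
open Literature.MathematicalPhysics.QuantumFieldTheory.Balaban1983to89.T3UnitScaleTilt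
open Literature.MathematicalPhysics.QuantumFieldTheory.Balaban1983to89.T3UnitLawDensityEML (ℰp)
open Literature.MathematicalPhysics.QuantumFieldTheory.Balaban1983to89.T4AxialGaugeSmallField (axialGauge boxPlaqs boxBonds castSite)
open Literature.MathematicalPhysics.QuantumFieldTheory.Balaban1983to89.B7Prop1Explicit (e)
open Literature.MathematicalPhysics.QuantumFieldTheory.Balaban1983to89.B8Lemma1NonAbelian (lowPart)
open Literature.MathematicalPhysics.QuantumLattice (fundamentalRep)
open Summit.QuantumFields.YangMills.Theorems.UnitScaleGibbsActionDerivativeSlotCalculus (actionDeriv actionDeriv₂ slotBond)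
open Summit.QuantumFields.YangMills.Theorems.UnitScaleGibbsDressedEventSplitCollar (integral_dist1_sq_iter_le_of_pointwise_collar)

namespace Summit.QuantumFields.YangMills.Theorems.GrossTransferStubLinTestOfPointwise

/-- ★★★ **`stub_linTest` (v3.1 text) FROM THE POINTWISE PACKAGE.**  If for every `L` there are constants `C ≥ 0`, `c`, `N > 0`, `γ₁ ∈ (0,1]` such that for
every member, coupling in the window, `K, j` with `N·j ≤ K` and every REFERENCE plaquette `a = ⟨x; 1, 2⟩` of level `j` there are a box `(lo, hi, n)`, test
fields `u_α` and weights `ω` with the rows R1–R7 of the stub AND the pointwise bound on the event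
`dist₁(Ū^j(∂a))² ≤ C·Σ_α (actionDeriv ρ (u α) (VU))² + Σ_b ω b·dist₁((VU) b)² + C·γ·L^{−(K−j)}` (`VU = U^{axialGauge U lo hi}`), THEN the v3.1 text of
`stub_linTest` holds with the same constants. [cite: GrossCMP1983, Thm 2.2] -/
theorem stub_linTest_of_pointwisePackage
    (hP : ∀ (L : ℕ), ∃ (C : ℝ) (c N : ℕ), 0 ≤ C ∧ 0 < N ∧ ∃ γ₁ : ℝ, 0 < γ₁ ∧ γ₁ ≤ 1 ∧
        ∀ (F : T3Family) (γ : ℝ), F.L = L → 0 < γ → γ ≤ γ₁ → ∀ (K j : ℕ), 1 ≤ j → N * j ≤ K →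
          ∀ a : Plaq (F.P K) j, a.μ.val = 1 → a.ν.val = 2 →
            ∃ (lo hi : Fin (F.P K).d → ℤ) (n : ℕ) (u : Fin 3 → PBond (F.P K) 0 → Matrix (Fin 2) (Fin 2) ℂ)
              (ω : PBond (F.P K) 0 → ℝ),
              (∀ κ, lo κ ≤ hi κ ∧ hi κ ≤ lo κ + n) ∧ 2 * n + 6 ≤ (F.P K).sitesPerDir 0 ∧
              (∀ α b, star (u α b) = -(u α b) ∧ (u α b).trace = 0) ∧
              (∀ α b, u α b ≠ 0 → ∃ x : Fin (F.P K).d → ℤ,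
                  lo + 1 ≤ x ∧ x + e b.dir + 1 ≤ hi ∧ b.src = castSite x ∧ lowPart b.dir (x - lo) ≠ 0) ∧
              (n : ℝ) ≤ C * (L : ℝ) ^ (c * j) * (1 + Real.log (γ * ((L : ℝ)⁻¹) ^ K)⁻¹) ∧
              (∀ α, ∑ p : Plaq (F.P K) 0, ‖u α (slotBond p 0) + u α (slotBond p 1) - u α (slotBond p 2) - u α (slotBond p 3)‖ ^ 2 ≤ C * (L : ℝ) ^ j) ∧
              (∀ α, ∑ b : PBond (F.P K) 0, ‖u α b‖ ^ 2 ≤ C * (L : ℝ) ^ (c * j)) ∧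
              (∀ b, 0 ≤ ω b) ∧ (∀ b, ω b ≠ 0 → b ∈ (boxBonds lo hi : Set (PBond (F.P K) 0))) ∧
              (n : ℝ) * (1 + Real.log (γ * ((L : ℝ)⁻¹) ^ K)⁻¹) * ∑ b : PBond (F.P K) 0, ω b ≤ C * (L : ℝ) ^ j ∧
              (∀ U : GaugeField (F.P K) 0 (Matrix.specialUnitaryGroup (Fin 2) ℂ),
                PlaqSmallOn (boxPlaqs lo hi) ((γ * ((L : ℝ)⁻¹) ^ K) ^ ((3 : ℝ) / 8)) U →
                (GaugeGroup.dist1 (GaugeField.plaqHol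
                    (Averaging.iter (fun i' => BlockAveraging.blockAvg (P := F.P K) (j := i') ℰp) j U) a)) ^ 2
                  ≤ C * ∑ α, (actionDeriv (fundamentalRep (Fin 2)) (u α) (GaugeField.gaugeAct (axialGauge U lo hi) U)) ^ 2
                    + ∑ b, ω b * (GaugeGroup.dist1 (GaugeField.gaugeAct (axialGauge U lo hi) U b)) ^ 2
                    + C * (γ * ((L : ℝ)⁻¹) ^ (K - j)))) :
    ∀ (L : ℕ), ∃ (C : ℝ) (c N : ℕ), 0 ≤ C ∧ 0 < N ∧ ∃ γ₁ : ℝ, 0 < γ₁ ∧ γ₁ ≤ 1 ∧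
        ∀ (F : T3Family) (γ : ℝ), F.L = L → 0 < γ → γ ≤ γ₁ → ∀ (K j : ℕ), 1 ≤ j → N * j ≤ K →
          ∀ a : Plaq (F.P K) j, a.μ.val = 1 → a.ν.val = 2 →
            ∃ (lo hi : Fin (F.P K).d → ℤ) (n : ℕ) (u : Fin 3 → PBond (F.P K) 0 → Matrix (Fin 2) (Fin 2) ℂ)
              (ω : PBond (F.P K) 0 → ℝ),
              (∀ κ, lo κ ≤ hi κ ∧ hi κ ≤ lo κ + n) ∧ 2 * n + 6 ≤ (F.P K).sitesPerDir 0 ∧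
              (∀ α b, star (u α b) = -(u α b) ∧ (u α b).trace = 0) ∧
              (∀ α b, u α b ≠ 0 → ∃ x : Fin (F.P K).d → ℤ,
                  lo + 1 ≤ x ∧ x + e b.dir + 1 ≤ hi ∧ b.src = castSite x ∧ lowPart b.dir (x - lo) ≠ 0) ∧
              (n : ℝ) ≤ C * (L : ℝ) ^ (c * j) * (1 + Real.log (γ * ((L : ℝ)⁻¹) ^ K)⁻¹) ∧
              (∀ α, ∑ p : Plaq (F.P K) 0, ‖u α (slotBond p 0) + u α (slotBond p 1) - u α (slotBond p 2) - u α (slotBond p 3)‖ ^ 2 ≤ C * (L : ℝ) ^ j) ∧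
              (∀ α, ∑ b : PBond (F.P K) 0, ‖u α b‖ ^ 2 ≤ C * (L : ℝ) ^ (c * j)) ∧
              (∀ b, 0 ≤ ω b) ∧ (∀ b, ω b ≠ 0 → b ∈ (boxBonds lo hi : Set (PBond (F.P K) 0))) ∧
              (n : ℝ) * (1 + Real.log (γ * ((L : ℝ)⁻¹) ^ K)⁻¹) * ∑ b : PBond (F.P K) 0, ω b ≤ C * (L : ℝ) ^ j ∧
              ∫ U, (GaugeGroup.dist1 (GaugeField.plaqHol
                  (Averaging.iter (fun i' => BlockAveraging.blockAvg (P := F.P K) (j := i') ℰp) j U) a)) ^ 2 ∂(gibbsK F ℰp γ K)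
                ≤ C * ∑ α, ∫ U, (actionDeriv (fundamentalRep (Fin 2)) (u α) (GaugeField.gaugeAct (axialGauge U lo hi) U)) ^ 2 ∂(gibbsK F ℰp γ K)
                  + ∑ b : PBond (F.P K) 0, ω b *
                      ∫ U, (GaugeGroup.dist1 (GaugeField.gaugeAct (axialGauge U lo hi) U b)) ^ 2 ∂(gibbsK F ℰp γ K)
                  + C * (γ * ((L : ℝ)⁻¹) ^ (K - j))
                  + 4 * (gibbsK F ℰp γ K).real {U | ¬ PlaqSmallOn (boxPlaqs lo hi) ((γ * ((L : ℝ)⁻¹) ^ K) ^ ((3 : ℝ) / 8)) U} := by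
  intro L
  obtain ⟨C, c, N, hC, hN, γ₁, hγ₁, hγ₁1, hmain⟩ := hP L
  refine ⟨C, c, N, hC, hN, γ₁, hγ₁, hγ₁1, ?_⟩
  intro F γ hFL hγ hγle K j hj hNj a hμ hν
  obtain ⟨lo, hi, n, u, ω, hbox, hn6, hsu, hsupp, hnC, hD, hS, hω0, hωsupp, hfloor, hpt⟩ := hmain F γ hFL hγ hγle K j hj hNj a hμ hν
  refine ⟨lo, hi, n, u, ω, hbox, hn6, hsu, hsupp, hnC, hD, hS, hω0, hωsupp, hfloor, ?_⟩
  have hL0 : (0 : ℝ) ≤ (L : ℝ) := Nat.cast_nonneg L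
  have hE : 0 ≤ C * (γ * ((L : ℝ)⁻¹) ^ (K - j)) := mul_nonneg hC (mul_nonneg hγ.le (pow_nonneg (inv_nonneg.mpr hL0) _))
  have h := integral_dist1_sq_iter_le_of_pointwise_collar F hγ.le K j a lo hi ((γ * ((L : ℝ)⁻¹) ^ K) ^ ((3 : ℝ) / 8)) u ω hω0 hC hE hpt
  linarith [h]

/-- ★★★ **`stub_linTest` (v3.2 text: NO logarithm in the box row and the floor) FROM THE POINTWISE PACKAGE** — the twin of the above for the v3.2 skeleton (23083 evidence #10), same proof.  If for every `L` there are constants `C ≥ 0`, `c`, `N > 0`, `γ₁ ∈ (0,1]` such that for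
every member, coupling in the window, `K, j` with `N·j ≤ K` and every REFERENCE plaquette `a = ⟨x; 1, 2⟩` of level `j` there are a box `(lo, hi, n)`, test
fields `u_α` and weights `ω` with the rows R1–R7 of the stub AND the pointwise bound on the event
`dist₁(Ū^j(∂a))² ≤ C·Σ_α (actionDeriv ρ (u α) (VU))² + Σ_b ω b·dist₁((VU) b)² + C·γ·L^{−(K−j)}` (`VU = U^{axialGauge U lo hi}`), THEN the v3.1 text of
`stub_linTest` holds with the same constants. [cite: GrossCMP1983, Thm 2.2] -/
theorem stub_linTest_of_pointwisePackage'
    (hP : ∀ (L : ℕ), ∃ (C : ℝ) (c N : ℕ), 0 ≤ C ∧ 0 < N ∧ ∃ γ₁ : ℝ, 0 < γ₁ ∧ γ₁ ≤ 1 ∧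
        ∀ (F : T3Family) (γ : ℝ), F.L = L → 0 < γ → γ ≤ γ₁ → ∀ (K j : ℕ), 1 ≤ j → N * j ≤ K →
          ∀ a : Plaq (F.P K) j, a.μ.val = 1 → a.ν.val = 2 →
            ∃ (lo hi : Fin (F.P K).d → ℤ) (n : ℕ) (u : Fin 3 → PBond (F.P K) 0 → Matrix (Fin 2) (Fin 2) ℂ)
              (ω : PBond (F.P K) 0 → ℝ),
              (∀ κ, lo κ ≤ hi κ ∧ hi κ ≤ lo κ + n) ∧ 2 * n + 6 ≤ (F.P K).sitesPerDir 0 ∧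
              (∀ α b, star (u α b) = -(u α b) ∧ (u α b).trace = 0) ∧
              (∀ α b, u α b ≠ 0 → ∃ x : Fin (F.P K).d → ℤ,
                  lo + 1 ≤ x ∧ x + e b.dir + 1 ≤ hi ∧ b.src = castSite x ∧ lowPart b.dir (x - lo) ≠ 0) ∧
              (n : ℝ) ≤ C * (L : ℝ) ^ (c * j) ∧
              (∀ α, ∑ p : Plaq (F.P K) 0, ‖u α (slotBond p 0) + u α (slotBond p 1) - u α (slotBond p 2) - u α (slotBond p 3)‖ ^ 2 ≤ C * (L : ℝ) ^ j) ∧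
              (∀ α, ∑ b : PBond (F.P K) 0, ‖u α b‖ ^ 2 ≤ C * (L : ℝ) ^ (c * j)) ∧
              (∀ b, 0 ≤ ω b) ∧ (∀ b, ω b ≠ 0 → b ∈ (boxBonds lo hi : Set (PBond (F.P K) 0))) ∧
              (n : ℝ) * ∑ b : PBond (F.P K) 0, ω b ≤ C * (L : ℝ) ^ j ∧
              (∀ U : GaugeField (F.P K) 0 (Matrix.specialUnitaryGroup (Fin 2) ℂ),
                PlaqSmallOn (boxPlaqs lo hi) ((γ * ((L : ℝ)⁻¹) ^ K) ^ ((3 : ℝ) / 8)) U →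
                (GaugeGroup.dist1 (GaugeField.plaqHol
                    (Averaging.iter (fun i' => BlockAveraging.blockAvg (P := F.P K) (j := i') ℰp) j U) a)) ^ 2
                  ≤ C * ∑ α, (actionDeriv (fundamentalRep (Fin 2)) (u α) (GaugeField.gaugeAct (axialGauge U lo hi) U)) ^ 2
                    + ∑ b, ω b * (GaugeGroup.dist1 (GaugeField.gaugeAct (axialGauge U lo hi) U b)) ^ 2
                    + C * (γ * ((L : ℝ)⁻¹) ^ (K - j)))) :
    ∀ (L : ℕ), ∃ (C : ℝ) (c N : ℕ), 0 ≤ C ∧ 0 < N ∧ ∃ γ₁ : ℝ, 0 < γ₁ ∧ γ₁ ≤ 1 ∧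
        ∀ (F : T3Family) (γ : ℝ), F.L = L → 0 < γ → γ ≤ γ₁ → ∀ (K j : ℕ), 1 ≤ j → N * j ≤ K →
          ∀ a : Plaq (F.P K) j, a.μ.val = 1 → a.ν.val = 2 →
            ∃ (lo hi : Fin (F.P K).d → ℤ) (n : ℕ) (u : Fin 3 → PBond (F.P K) 0 → Matrix (Fin 2) (Fin 2) ℂ)
              (ω : PBond (F.P K) 0 → ℝ),
              (∀ κ, lo κ ≤ hi κ ∧ hi κ ≤ lo κ + n) ∧ 2 * n + 6 ≤ (F.P K).sitesPerDir 0 ∧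
              (∀ α b, star (u α b) = -(u α b) ∧ (u α b).trace = 0) ∧
              (∀ α b, u α b ≠ 0 → ∃ x : Fin (F.P K).d → ℤ,
                  lo + 1 ≤ x ∧ x + e b.dir + 1 ≤ hi ∧ b.src = castSite x ∧ lowPart b.dir (x - lo) ≠ 0) ∧
              (n : ℝ) ≤ C * (L : ℝ) ^ (c * j) ∧
              (∀ α, ∑ p : Plaq (F.P K) 0, ‖u α (slotBond p 0) + u α (slotBond p 1) - u α (slotBond p 2) - u α (slotBond p 3)‖ ^ 2 ≤ C * (L : ℝ) ^ j) ∧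
              (∀ α, ∑ b : PBond (F.P K) 0, ‖u α b‖ ^ 2 ≤ C * (L : ℝ) ^ (c * j)) ∧
              (∀ b, 0 ≤ ω b) ∧ (∀ b, ω b ≠ 0 → b ∈ (boxBonds lo hi : Set (PBond (F.P K) 0))) ∧
              (n : ℝ) * ∑ b : PBond (F.P K) 0, ω b ≤ C * (L : ℝ) ^ j ∧
              ∫ U, (GaugeGroup.dist1 (GaugeField.plaqHol
                  (Averaging.iter (fun i' => BlockAveraging.blockAvg (P := F.P K) (j := i') ℰp) j U) a)) ^ 2 ∂(gibbsK F ℰp γ K)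
                ≤ C * ∑ α, ∫ U, (actionDeriv (fundamentalRep (Fin 2)) (u α) (GaugeField.gaugeAct (axialGauge U lo hi) U)) ^ 2 ∂(gibbsK F ℰp γ K)
                  + ∑ b : PBond (F.P K) 0, ω b *
                      ∫ U, (GaugeGroup.dist1 (GaugeField.gaugeAct (axialGauge U lo hi) U b)) ^ 2 ∂(gibbsK F ℰp γ K)
                  + C * (γ * ((L : ℝ)⁻¹) ^ (K - j))
                  + 4 * (gibbsK F ℰp γ K).real {U | ¬ PlaqSmallOn (boxPlaqs lo hi) ((γ * ((L : ℝ)⁻¹) ^ K) ^ ((3 : ℝ) / 8)) U} := by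
  intro L
  obtain ⟨C, c, N, hC, hN, γ₁, hγ₁, hγ₁1, hmain⟩ := hP L
  refine ⟨C, c, N, hC, hN, γ₁, hγ₁, hγ₁1, ?_⟩
  intro F γ hFL hγ hγle K j hj hNj a hμ hν
  obtain ⟨lo, hi, n, u, ω, hbox, hn6, hsu, hsupp, hnC, hD, hS, hω0, hωsupp, hfloor, hpt⟩ := hmain F γ hFL hγ hγle K j hj hNj a hμ hν
  refine ⟨lo, hi, n, u, ω, hbox, hn6, hsu, hsupp, hnC, hD, hS, hω0, hωsupp, hfloor, ?_⟩
  have hL0 : (0 : ℝ) ≤ (L : ℝ) := Nat.cast_nonneg L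
  have hE : 0 ≤ C * (γ * ((L : ℝ)⁻¹) ^ (K - j)) := mul_nonneg hC (mul_nonneg hγ.le (pow_nonneg (inv_nonneg.mpr hL0) _))
  have h := integral_dist1_sq_iter_le_of_pointwise_collar F hγ.le K j a lo hi ((γ * ((L : ℝ)⁻¹) ^ K) ^ ((3 : ℝ) / 8)) u ω hω0 hC hE hpt
  linarith [h]

end Summit.QuantumFields.YangMills.Theorems.GrossTransferStubLinTestOfPointwise

end
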